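import Literature.InformationTheory.QuantumCodes.SubsystemCodeTradeoff
import HarnessLib

/-!
# Bravyi 2011, Eq. (1) for subsystem codes: `kd² = O(n)` when BOTH the gauge group and the stabilizer group have
# local generators — proof on the `D`-dimensional torus (`k · d^{2/(D−1)} ≤ c · n`)

S. Bravyi, *Subsystem codes with spatially local generators*, Phys. Rev. A 83 (2011) 012320 = arXiv:1008.1029
[Bravyi2011Subsystem]. §1 (chunk p0004 L21–23): «We also prove that the original bound Eq. (1) [`kd² = O(n)`] holds
for any 2D subsystem code in which both stabilizer group and the gauge group have spatially local generators. The
topological subsystem codes of [Bombin] provide an example of such codes.» §8, second half (p0013 L30–60): «assuming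
that both `𝒢` and `𝒮` have spatially local generators with a constant interaction range `r` and `r_s` respectively.
Consider a partition of the lattice `Λ = ABC` … The regions `A`, `B` consist of blocks `A_1,…,A_m` and `B_1,…,B_m`
… of size `R × R` with `R = Ω(d)` such that `l(A_i) = 0` and `l(B_i) = 0` [holographic Lemma 4]. The region `C`
consists of disks … so that adjacent blocks in `A` and adjacent blocks in `B` are separated … any generator overlaps
with at most one block in `A` and with at most one block in `B`. Applying the same arguments as above we get
`l_bare(A) = 0` and thus Lemma 2 implies `l(BC) = 2k`. Let us assume that `|C| < k` and show that it leads to a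
contradiction. Indeed, choose any set of `2k` independent dressed logical operators `P_1,…,P_{2k} ∈ 𝒞(𝒮)∖𝒢` supported
inside `BC` … Applying Fact 1 to region `C` [«Suppose `2|M| < dim 𝒢`. Then `𝒢` contains at least one non-identity
operator acting trivially on `M`», p0011 L48–55] … there exists at least one non-trivial dressed logical operator
`P ∈ 𝒞(𝒮)∖𝒢` supported only inside `B`. Let `P_i` be the restriction of `P` onto a block `B_i` … Since any generator
of `𝒮` overlaps with at most one block in `B` we conclude that `P_i ∈ 𝒞(𝒮)`. However, there must exist at least one
block `B_i` such that `P_i ∉ 𝒢` since otherwise `P ∈ 𝒢`. Then `P_i` is a non-trivial dressed logical operator, that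
is, `l(B_i) > 0` which is a contradiction. Hence … `|C| ≥ k`. Simple algebra shows that `|C| = O(n/R²) = O(n/d²)`
which yields `kd² = O(n)`.»

THIS FILE PROVES it on the torus `(ℤ/L)^D`, `D ≥ 2`, with the BPT partition of `LocalCodeTradeoffTorus.lean`
(`A` = pure blocks `blockLab`, `B` = corridor segments `corrLab`, `C` ⊆ the codimension-2 corner set `TwoBad`; both
families lie in side-`R` hypercubes, gauge-correctable by the holographic growth of `SubsystemCodeTradeoff.lean`):
`Bravyi2011_kd2_le_cn_torus (D w) (hD : 2 ≤ D) : ∃ c > 0, ∀ L n k d e G, HasLocalGeneratorsPeriodic e w G →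
HasLocalGeneratorsPeriodic e w (gaugeStabilizer G) → IsSubsystemCode G k d → k · d^{2/(D−1)} ≤ c · n` — for `Ḡ`
self-orthogonal (`S̄ = Ḡ`) this is the tree's `BravyiPoulinTerhal2010_eq2_torus`; printed `D = 2` form
`Bravyi2011_kd2_le_cn_torus_two` (`kd² ≤ c n`) and open boundaries `Bravyi2011_kd2_le_cn`.

Steps as printed: `isGaugeCorrectable_of_fibers` («`P_i ∈ 𝒞(𝒮)` … `l(B_i) > 0` contradiction»: a union of blocks
decoupled for the STABILIZER generators, each gauge-correctable, is gauge-correctable); `IsSubsystemCode.le_card_of_split`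
(Fact 1 + `l(BC) = 2k` ⇒ `k ≤ |C|`, by rank–nullity for the restriction to `C`); the integer master lemma
`SubsystemTorus.exists_scale` (all degenerate regimes as in the stabilizer file) and the exponent step
`BPTTorus.real_step`.

## Mathlib / tree search

Tree: `SubsystemCodes.lean`, `SubsystemCodeTradeoff.lean` (`bareFree_of_fibers`, `IsSubsystemCode.dist_le_card_compl_of_bareFree`,
`SubsystemTorus.exists_gaugeCorrectable_cube`), `BPTTorus.{blockLab, corrLab, TwoBad, blockLab_separated, corrLab_separated,
fiber_blockLab_subset_cube, fiber_corrLab_subset_cube, twoBad_of_labels_none, card_filter_twoBad_le, card_badFin_le,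
card_cube_eq, real_step}` (LocalCodeTradeoffTorus.lean); `proj_fiber_mem_sympDual`, `eq_sum_proj_fiber`,
`proj_fiber_none_eq_zero`, `finrank_supportedOn_eq` (CorrectableRegions.lean); Mathlib `LinearMap.finrank_range_add_finrank_ker`,
`Submodule.finrank_map_subtype_eq`.
-/

namespace Literature.InformationTheory.QuantumCodes

open Finset Module
open Classical

variable {n : ℕ}

/-! ### 1. Two geometry-free steps -/

section Generic

variable {G : Submodule (ZMod 2) (SympVec n)}

/-- **«`P_i ∈ 𝒞(𝒮)` … then `P_i` is a non-trivial dressed logical operator, `l(B_i) > 0`, a contradiction»**: if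
the STABILIZER space is `S̄ = ⟨σ⟩` with every `σ_a` meeting at most one block of the labelling `β`, and every block is
gauge-correctable, then the union of the blocks is gauge-correctable. [cite: Bravyi2011Subsystem, §8 (p. 13, the argument after Eq. (assume))] -/
theorem isGaugeCorrectable_of_fibers {ι κ : Type*} [DecidableEq κ] (σ : ι → SympVec n) (β : Fin n → Option κ)
    (hS : gaugeStabilizer G = Submodule.span (ZMod 2) (Set.range σ))
    (hsep : ∀ a, ∀ q ∈ sympSupport (σ a), ∀ q' ∈ sympSupport (σ a), ∀ i i' : κ,
      β q = some i → β q' = some i' → i = i')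
    (hcorr : ∀ i, IsGaugeCorrectable G (fiber β (some i))) :
    IsGaugeCorrectable G (univ.filter fun q => (β q).isSome) := by
  intro P hPd hPs
  rw [eq_sum_proj_fiber β P]
  refine Submodule.sum_mem _ fun o _ => ?_
  rcases o with _ | i
  · rw [proj_fiber_none_eq_zero β hPs]; exact Submodule.zero_mem _
  · refine hcorr i _ ?_ (proj_mem_supportedOn _ P)
    rw [hS] at hPd ⊢
    exact proj_fiber_mem_sympDual β σ hsep hPd hPs i

/-- **Fact 1 + `l(BC) = 2k` ⇒ `|C| ≥ k`.** If no bare logical operator is supported on `A`, the complement of `A`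
is covered by `B ∪ C`, and `B` is gauge-correctable (no dressed logical operator on `B`), then `k ≤ |C|`: the
dressed logical operators on `Ā` form a space of dimension `dim(Ḡ ∩ 𝒫(Ā)) + 2k`; those vanishing on `C` live on
`B`, hence in `Ḡ`, so restriction to `C` (rank–nullity, `dim 𝒫(C) = 2|C|`) forces `2k ≤ 2|C|`.
[cite: Bravyi2011Subsystem, §6 Fact 1 (p. 11) and §8 (p. 13: «Let us assume that |C| < k and show that it leads to a contradiction»)] -/
theorem IsSubsystemCode.le_card_of_split {k d : ℕ} (h : IsSubsystemCode G k d) {A B C : Finset (Fin n)}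
    (hA : (sympDual G ⊓ supportedOn A : Submodule (ZMod 2) (SympVec n)) ≤ G) (hcover : Aᶜ ⊆ B ∪ C)
    (hB : IsGaugeCorrectable G B) : k ≤ #C := by
  -- l(Ā) = 2k
  have hcount := h.bareDressed_count A
  have heq : (sympDual G ⊓ supportedOn A : Submodule (ZMod 2) (SympVec n)) = gaugeStabilizer G ⊓ supportedOn A :=
    le_antisymm (fun v hv => ⟨⟨hA hv, hv.1⟩, hv.2⟩) (inf_le_inf_right _ (gaugeStabilizer_le_sympDual G))
  rw [heq] at hcount
  set V : Submodule (ZMod 2) (SympVec n) := sympDual (gaugeStabilizer G) ⊓ supportedOn Aᶜ with hV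
  -- restriction to C
  let f : V →ₗ[ZMod 2] SympVec n := (proj C).comp V.subtype
  have hrange : finrank (ZMod 2) (LinearMap.range f) ≤ 2 * #C := by
    rw [← finrank_supportedOn_eq C]
    refine Submodule.finrank_mono ?_
    rintro _ ⟨v, rfl⟩
    exact proj_mem_supportedOn C (v : SympVec n)
  -- the kernel lives on B, hence in Ḡ ∩ 𝒫(Ā)
  have hker : (LinearMap.ker f).map V.subtype ≤ G ⊓ supportedOn Aᶜ := by
    rintro _ ⟨v, hv, rfl⟩
    have hv0 : proj C (v : SympVec n) = 0 := LinearMap.mem_ker.1 (hv : v ∈ LinearMap.ker f)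
    obtain ⟨hvd, hvA⟩ :=
      (show (v : SympVec n) ∈ (sympDual (gaugeStabilizer G) ⊓ supportedOn Aᶜ : Submodule (ZMod 2) (SympVec n))
        from v.2)
    refine ⟨hB _ hvd fun i hiB => ?_, hvA⟩
    by_cases hiC : i ∈ C
    · have h1 := congrArg (fun w : SympVec n => w.1 i) hv0
      have h2 := congrArg (fun w : SympVec n => w.2 i) hv0
      simp only [proj_apply_fst, proj_apply_snd, if_pos hiC, Prod.fst_zero, Prod.snd_zero,
        Pi.zero_apply] at h1 h2
      exact ⟨h1, h2⟩
    · have hiA : i ∉ Aᶜ := fun hiA => by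
        have := hcover hiA
        rw [mem_union] at this
        rcases this with h' | h'
        · exact hiB h'
        · exact hiC h'
      exact hvA i hiA
  have hkerle : finrank (ZMod 2) (LinearMap.ker f) ≤
      finrank (ZMod 2) (G ⊓ supportedOn Aᶜ : Submodule (ZMod 2) (SympVec n)) := by
    rw [← Submodule.finrank_map_subtype_eq V (LinearMap.ker f)]
    exact Submodule.finrank_mono hker
  have hrn := LinearMap.finrank_range_add_finrank_ker f
  omega

end Generic

/-! ### 2. The partition `Λ = A ∪ B ∪ C` for subsystem codes -/

namespace SubsystemTorus

open BPTTorus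

section Partition

variable {D L : ℕ} {e : Fin n ≃ (Fin D → Fin L)} {Q t : ℕ} {ι ι' : Type*} {γ : ι → SympVec n}
  {σ : ι' → SympVec n} {G : Submodule (ZMod 2) (SympVec n)}

/-- **`k ≤ |C|` on the torus partition**: gauge generators of range `t + 1` (blocks of `A` decoupled), stabilizer
generators of range `t + 1` (segments of `B` decoupled, thanks to the corner set `C`), every side-`R` hypercube
gauge-correctable ⇒ `k ≤ |TwoBad|`. [cite: Bravyi2011Subsystem, §8 (p. 13: «|C| ≥ k»)] -/
theorem le_card_filter_twoBad {k d R : ℕ} (hG : G = Submodule.span (ZMod 2) (Set.range γ))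
    (hS : gaugeStabilizer G = Submodule.span (ZMod 2) (Set.range σ)) (hcode : IsSubsystemCode G k d)
    (hγ : ∀ a, IsCubeLocalPeriodic e (t + 1) (γ a)) (hσ : ∀ a, IsCubeLocalPeriodic e (t + 1) (σ a))
    (hQ : 0 < Q) (hL : 0 < L) (h2 : 2 * t * Q ≤ L) (hLQ : L ≤ Q * (R + t))
    (hcube : ∀ o, IsGaugeCorrectable G (cube e o R)) :
    k ≤ #(univ.filter fun q : Fin n => TwoBad e Q t q) := by
  have hA : (sympDual G ⊓ supportedOn (univ.filter fun q => (blockLab e Q t q).isSome) :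
      Submodule (ZMod 2) (SympVec n)) ≤ G :=
    bareFree_of_fibers γ (blockLab e Q t) hG (fun a => blockLab_separated (hγ a)) fun P => by
      obtain ⟨o, ho⟩ := fiber_blockLab_subset_cube (e := e) (t := t) hQ hL hLQ P
      exact (hcube o).mono ho
  have hB : IsGaugeCorrectable G (univ.filter fun q => (corrLab e Q t q).isSome) :=
    isGaugeCorrectable_of_fibers σ (corrLab e Q t) hS (fun a => corrLab_separated hQ hL h2 (hσ a)) fun TP => by
      obtain ⟨o, ho⟩ := fiber_corrLab_subset_cube (e := e) hQ hL h2 hLQ TP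
      exact (hcube o).mono ho
  refine hcode.le_card_of_split hA (fun q hq => ?_) hB
  rw [mem_compl, mem_filter] at hq
  rw [mem_union]
  by_cases hBq : (corrLab e Q t q).isSome
  · exact Or.inl (mem_filter.2 ⟨mem_univ _, hBq⟩)
  · right
    have hA' : blockLab e Q t q = none := Option.not_isSome_iff_eq_none.1 fun h' => hq ⟨mem_univ _, h'⟩
    have hB' : corrLab e Q t q = none := Option.not_isSome_iff_eq_none.1 hBq
    exact mem_filter.2 ⟨mem_univ _, twoBad_of_labels_none hA' hB'⟩

end Partition

/-- `a^D − b^D ≤ (a − b)·D·a^{D−1}` for `b ≤ a` (telescoping; private copy of the helper of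
`LocalCodeTradeoffTorus.lean`). [folklore] -/
private theorem pow_sub_pow_le' (a b : ℕ) (hab : b ≤ a) : ∀ D : ℕ, a ^ D - b ^ D ≤ (a - b) * (D * a ^ (D - 1))
  | 0 => by simp
  | D + 1 => by
    have ih := pow_sub_pow_le' a b hab D
    rw [Nat.add_sub_cancel]
    apply Nat.sub_le_iff_le_add'.2
    rcases Nat.eq_zero_or_pos D with hD | hD
    · subst hD; simp; omega
    · have haD : a * a ^ (D - 1) = a ^ D := by
        rw [← pow_succ']; congr 1; omega
      have h1 : a ^ D ≤ b ^ D + (a - b) * (D * a ^ (D - 1)) := Nat.sub_le_iff_le_add'.1 ih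
      calc a ^ (D + 1) = a * a ^ D := by ring
        _ ≤ a * (b ^ D + (a - b) * (D * a ^ (D - 1))) := Nat.mul_le_mul_left _ h1
        _ = a * b ^ D + (a - b) * (D * (a * a ^ (D - 1))) := by ring
        _ = (b + (a - b)) * b ^ D + (a - b) * (D * a ^ D) := by rw [haD]; congr 1; rw [Nat.add_sub_cancel' hab]
        _ = b ^ (D + 1) + (a - b) * b ^ D + (a - b) * (D * a ^ D) := by ring
        _ ≤ b ^ (D + 1) + (a - b) * a ^ D + (a - b) * (D * a ^ D) := by gcongr
        _ = b ^ (D + 1) + (a - b) * ((D + 1) * a ^ (D + 1 - 1)) := by rw [Nat.add_sub_cancel]; ring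

/-! ### 3. Assembly -/

section Assembly

variable {D L : ℕ}

/-- **The integer form, subsystem version with local stabilizer generators**: for a subsystem code with `k ≥ 1`
on `(ℤ/L)^D`, `D ≥ 2`, whose gauge space AND stabilizer space are spanned by generators of range `t + 1` (`t ≥ 1`),
there is `M ≥ 1` with `k·M² ≤ 36D²t²·n` and `d ≤ C_B(t,D)·M^{D−1}`.
[cite: Bravyi2011Subsystem, §8 (p. 13: «|C| = O(n/R²) = O(n/d²) which yields kd² = O(n)»)] -/
theorem exists_scale {k d t : ℕ} (hD : 2 ≤ D) (ht : 1 ≤ t) (e : Fin n ≃ (Fin D → Fin L))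
    {G : Submodule (ZMod 2) (SympVec n)} (hlocG : HasLocalGeneratorsPeriodic e (t + 1) G)
    (hlocS : HasLocalGeneratorsPeriodic e (t + 1) (gaugeStabilizer G))
    (hcode : IsSubsystemCode G k d) (hk : 1 ≤ k) :
    ∃ M, 1 ≤ M ∧ k * M ^ 2 ≤ 36 * D ^ 2 * t ^ 2 * n ∧
      d ≤ (4 * t * D * 2 ^ (D - 1) + (6 * t) ^ D + 4 * t * D * (7 * t) ^ (D - 1) + 1) * M ^ (D - 1) := by
  set CB := 4 * t * D * 2 ^ (D - 1) + (6 * t) ^ D + 4 * t * D * (7 * t) ^ (D - 1) + 1 with hCB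
  have hn : n = L ^ D := by
    have h := Fintype.card_congr e
    simpa using h
  have hkn : k ≤ n := by
    have h1 := hcode.1
    have h2 := finrank_sympDual_add G
    omega
  have hD2 : 1 ≤ D ^ 2 := Nat.one_le_pow _ _ (by omega)
  have ht2 : 1 ≤ t ^ 2 := Nat.one_le_pow _ _ ht
  have hCA1 : 1 ≤ 36 * D ^ 2 * t ^ 2 := by nlinarith
  have triv : ∀ {B : ℕ}, d ≤ B → B ≤ CB →
      ∃ M, 1 ≤ M ∧ k * M ^ 2 ≤ 36 * D ^ 2 * t ^ 2 * n ∧ d ≤ CB * M ^ (D - 1) := by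
    intro B hdB hB
    refine ⟨1, le_rfl, ?_, ?_⟩
    · rw [one_pow, mul_one]
      exact hkn.trans (Nat.le_mul_of_pos_left n hCA1)
    · rw [one_pow, mul_one]; exact hdB.trans hB
  have hn1 : 1 ≤ n := hk.trans hkn
  have hL : 0 < L := by
    rcases Nat.eq_zero_or_pos L with h | h
    · exfalso; rw [h, zero_pow (by omega)] at hn; omega
    · exact h
  -- generators
  set T : Set (SympVec n) := {v | v ∈ G ∧ IsCubeLocalPeriodic e (t + 1) v} with hT
  have hG : G = Submodule.span (ZMod 2) (Set.range (Subtype.val : T → SympVec n)) := by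
    rw [Subtype.range_coe]
    exact le_antisymm hlocG (Submodule.span_le.2 fun v hv => hv.1)
  have hγ : ∀ a : T, IsCubeLocalPeriodic e (t + 1) (a : SympVec n) := fun a => a.2.2
  set T' : Set (SympVec n) := {v | v ∈ gaugeStabilizer G ∧ IsCubeLocalPeriodic e (t + 1) v} with hT'
  have hS : gaugeStabilizer G = Submodule.span (ZMod 2) (Set.range (Subtype.val : T' → SympVec n)) := by
    rw [Subtype.range_coe]
    exact le_antisymm hlocS (Submodule.span_le.2 fun v hv => hv.1)
  have hσ : ∀ a : T', IsCubeLocalPeriodic e (t + 1) (a : SympVec n) := fun a => a.2.2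
  -- d ≤ 1
  rcases Nat.lt_or_ge d 2 with hd | hd
  · exact triv (B := 1) (by omega) (by omega)
  -- d ≤ n
  have hdn : d ≤ n := by
    have h := hcode.dist_le_card_compl_of_bareFree hk (M := (∅ : Finset (Fin n)))
      (by rintro v ⟨-, hv⟩
          have h0 : v = 0 := by
            ext i
            · exact (hv i (by simp)).1
            · exact (hv i (by simp)).2
          rw [h0]; exact G.zero_mem)
    simpa using h
  -- tiny torus
  by_cases hLt : L < 6 * t
  · refine triv hdn ?_
    have : L ^ D ≤ (6 * t) ^ D := Nat.pow_le_pow_left hLt.le D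
    rw [hn]; omega
  rw [not_lt] at hLt
  -- growth
  obtain ⟨R, hR1, hRL, hcube, halt⟩ := exists_gaugeCorrectable_cube hG hγ hcode.2 hL ht hd
  have hLD : L ^ (D - 2) * L ^ 2 = L ^ D := by rw [← pow_add]; congr 1; omega
  have hfree_cube : ∀ o, (sympDual G ⊓ supportedOn (cube e o R) : Submodule (ZMod 2) (SympVec n)) ≤ G :=
    fun o v hv => hcube o v (sympDual_le_sympDual_gaugeStabilizer G hv.1) hv.2
  rcases halt with hdR | hbig
  swap
  · -- blocks have outgrown the torus: two periods
    have h2Q : 2 * t * 2 ≤ L := by omega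
    have hLQ : L ≤ 2 * (R + t) := by omega
    have hk' := le_card_filter_twoBad hG hS hcode hγ hσ (by norm_num) hL h2Q hLQ hcube
    have hC := card_filter_twoBad_le (e := e) (Q := 2) (t := t) hL
    have hbad := card_badFin_le (L := L) (t := t) (Q := 2) (by norm_num) hL h2Q
    refine ⟨L, hL, ?_, ?_⟩
    · have h1 : k ≤ D * D * ((3 * t * 2) ^ 2 * L ^ (D - 2)) := hk'.trans (hC.trans (by gcongr))
      calc k * L ^ 2 ≤ D * D * ((3 * t * 2) ^ 2 * L ^ (D - 2)) * L ^ 2 := Nat.mul_le_mul_right _ h1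
        _ = 36 * D ^ 2 * t ^ 2 * (L ^ (D - 2) * L ^ 2) := by ring
        _ = 36 * D ^ 2 * t ^ 2 * n := by rw [hLD, hn]
    · have h1 := hcode.dist_le_card_compl_of_bareFree hk (hfree_cube fun _ => ⟨0, hL⟩)
      rw [card_compl, Fintype.card_fin, card_cube_eq hL _ hRL] at h1
      have h2 : n - R ^ D ≤ L ^ D - (L - 2 * t) ^ D := by
        rw [hn]
        exact Nat.sub_le_sub_left (Nat.pow_le_pow_left (by omega) D) _
      have h3 : L ^ D - (L - 2 * t) ^ D ≤ 2 * t * (D * L ^ (D - 1)) := by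
        have h' := pow_sub_pow_le' L (L - 2 * t) (Nat.sub_le _ _) D
        rwa [show L - (L - 2 * t) = 2 * t by omega] at h'
      have h4 : (2 * t) * (D * L ^ (D - 1)) ≤ CB * L ^ (D - 1) := by
        have hcb : 2 * t * D ≤ CB := by
          have h2D : 1 ≤ 2 ^ (D - 1) := Nat.one_le_two_pow
          have : 2 * t * D ≤ 4 * t * D * 2 ^ (D - 1) :=
            calc 2 * t * D ≤ 4 * t * D := Nat.mul_le_mul_right _ (by omega)
              _ = 4 * t * D * 1 := (mul_one _).symm
              _ ≤ 4 * t * D * 2 ^ (D - 1) := Nat.mul_le_mul_left _ h2D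
          omega
        calc 2 * t * (D * L ^ (D - 1)) = (2 * t * D) * L ^ (D - 1) := by ring
          _ ≤ CB * L ^ (D - 1) := Nat.mul_le_mul_right _ hcb
      omega
  · -- frame count reached d
    have hd4 : d ≤ 4 * t * (D * (R + 2 * t) ^ (D - 1)) :=
      hdR.trans ((pow_sub_pow_le' _ _ (by omega) D).trans (Nat.mul_le_mul_right _ (by omega)))
    by_cases hR5 : R < 5 * t
    · refine triv hd4 ?_
      have : (R + 2 * t) ^ (D - 1) ≤ (7 * t) ^ (D - 1) := Nat.pow_le_pow_left (by omega) _
      calc 4 * t * (D * (R + 2 * t) ^ (D - 1)) ≤ 4 * t * (D * (7 * t) ^ (D - 1)) := by gcongr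
        _ = 4 * t * D * (7 * t) ^ (D - 1) := by ring
        _ ≤ CB := by omega
    rw [not_lt] at hR5
    set p := R + t with hp
    have hp0 : 0 < p := by omega
    set Q := (L + p - 1) / p with hQdef
    have hQ1 : 1 ≤ Q := by
      rw [hQdef, Nat.le_div_iff_mul_le hp0]; omega
    have hdm := Nat.div_add_mod (L + p - 1) p
    have hml := Nat.mod_lt (L + p - 1) hp0
    have hLQ : L ≤ Q * p := by
      have : p * ((L + p - 1) / p) = Q * p := by rw [hQdef]; ring
      omega
    have hQp : Q * p < L + p := by
      have : p * ((L + p - 1) / p) = Q * p := by rw [hQdef]; ring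
      omega
    have hQone : L ≤ p → Q = 1 := by
      intro hpL
      have : Q < 2 := by
        by_contra h
        rw [not_lt] at h
        have : 2 * p ≤ Q * p := Nat.mul_le_mul_right _ h
        omega
      omega
    have h2Q : 2 * t * Q ≤ L := by
      rcases Nat.lt_or_ge p L with hpL | hpL
      · have h1 : 2 * t * (L + p) ≤ L * p :=
          calc 2 * t * (L + p) ≤ 2 * t * (L + L) := Nat.mul_le_mul_left _ (by omega)
            _ = (4 * t) * L := by ring
            _ ≤ p * L := Nat.mul_le_mul_right _ (by omega)
            _ = L * p := by ring
        have h3 : 2 * t * Q * p < L * p :=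
          calc 2 * t * Q * p = 2 * t * (Q * p) := by ring
            _ < 2 * t * (L + p) := Nat.mul_lt_mul_of_pos_left hQp (by omega)
            _ ≤ L * p := h1
        exact le_of_lt (Nat.lt_of_mul_lt_mul_right h3)
      · rw [hQone hpL]; omega
    have hk' := le_card_filter_twoBad hG hS hcode hγ hσ (by omega) hL h2Q hLQ hcube
    have hC := card_filter_twoBad_le (e := e) (Q := Q) (t := t) hL
    have hbad := card_badFin_le (L := L) (t := t) (by omega : 0 < Q) hL h2Q
    have hk2 : k ≤ D * D * ((3 * t * Q) ^ 2 * L ^ (D - 2)) := hk'.trans (hC.trans (by gcongr))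
    rcases Nat.lt_or_ge p L with hpL | hpL
    · refine ⟨p, hp0, ?_, ?_⟩
      · have hQp2 : Q * p ≤ 2 * L := by omega
        calc k * p ^ 2 ≤ D * D * ((3 * t * Q) ^ 2 * L ^ (D - 2)) * p ^ 2 := Nat.mul_le_mul_right _ hk2
          _ = 9 * D ^ 2 * t ^ 2 * (Q * p) ^ 2 * L ^ (D - 2) := by ring
          _ ≤ 9 * D ^ 2 * t ^ 2 * (2 * L) ^ 2 * L ^ (D - 2) := by gcongr
          _ = 36 * D ^ 2 * t ^ 2 * (L ^ (D - 2) * L ^ 2) := by ring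
          _ = 36 * D ^ 2 * t ^ 2 * n := by rw [hLD, hn]
      · have h1 : (R + 2 * t) ^ (D - 1) ≤ (2 * p) ^ (D - 1) := Nat.pow_le_pow_left (by omega) _
        calc d ≤ 4 * t * (D * (R + 2 * t) ^ (D - 1)) := hd4
          _ ≤ 4 * t * (D * (2 * p) ^ (D - 1)) := by gcongr
          _ = (4 * t * D * 2 ^ (D - 1)) * p ^ (D - 1) := by rw [mul_pow]; ring
          _ ≤ CB * p ^ (D - 1) := Nat.mul_le_mul_right _ (by omega)
    · have hQ1' := hQone hpL
      refine ⟨L, hL, ?_, ?_⟩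
      · calc k * L ^ 2 ≤ D * D * ((3 * t * Q) ^ 2 * L ^ (D - 2)) * L ^ 2 := Nat.mul_le_mul_right _ hk2
          _ = 9 * D ^ 2 * t ^ 2 * Q ^ 2 * (L ^ (D - 2) * L ^ 2) := by ring
          _ ≤ 36 * D ^ 2 * t ^ 2 * (L ^ (D - 2) * L ^ 2) := by
              rw [hQ1']; exact Nat.mul_le_mul_right _ (by nlinarith)
          _ = 36 * D ^ 2 * t ^ 2 * n := by rw [hLD, hn]
      · have h1 : (R + 2 * t) ^ (D - 1) ≤ (2 * L) ^ (D - 1) := Nat.pow_le_pow_left (by omega) _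
        calc d ≤ 4 * t * (D * (R + 2 * t) ^ (D - 1)) := hd4
          _ ≤ 4 * t * (D * (2 * L) ^ (D - 1)) := by gcongr
          _ = (4 * t * D * 2 ^ (D - 1)) * L ^ (D - 1) := by rw [mul_pow]; ring
          _ ≤ CB * L ^ (D - 1) := Nat.mul_le_mul_right _ (by omega)

end Assembly

end SubsystemTorus

/-! ### The theorems -/

/-- **Bravyi 2011, Eq. (1) for subsystem codes with local gauge AND stabilizer generators, `D`-dimensional torus form
`k · d^{2/(D−1)} ≤ c(w, D) · n` — proved.** «We also prove that the original bound Eq. (1) [`kd² = O(n)`] holds for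
any 2D subsystem code in which both stabilizer group and the gauge group have spatially local generators.» Typed:
for `D ≥ 2` and a range `w` there is `c > 0` such that every gauge space `Ḡ` on `(ℤ/L)^D` which is spanned by
range-`w` elements AND whose stabilizer space `Ḡ ⊓ Ḡ⊥` is spanned by range-`w` elements of it (Bravyi's `r, r_s ≤ w`),
with `k` logical qubits and dressed distance `≥ d`, satisfies `k · d^{2/(D−1)} ≤ c · n`. For `Ḡ` self-orthogonal this
is `BravyiPoulinTerhal2010_eq2_torus`. The paper states `D = 2` (`Bravyi2011_kd2_le_cn_torus_two`); the
`D`-dimensional statement is its §8 proof run in `D` dimensions. Column: proved theorem.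
[cite: Bravyi2011Subsystem, §1 after Eq. (2) (p. 4) and §8 second half (p. 13)] -/
theorem Bravyi2011_kd2_le_cn_torus (D w : ℕ) (hD : 2 ≤ D) :
    ∃ c : ℝ, 0 < c ∧ ∀ (L n k d : ℕ) (e : Fin n ≃ (Fin D → Fin L)) (G : Submodule (ZMod 2) (SympVec n)),
      HasLocalGeneratorsPeriodic e w G → HasLocalGeneratorsPeriodic e w (gaugeStabilizer G) →
        IsSubsystemCode G k d → (k : ℝ) * (d : ℝ) ^ ((2 : ℝ) / ((D : ℝ) - 1)) ≤ c * n := by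
  obtain ⟨t, ht, hwt⟩ : ∃ t : ℕ, 1 ≤ t ∧ w ≤ t + 1 := ⟨max w 2 - 1, by omega, by omega⟩
  refine ⟨((36 * D ^ 2 * t ^ 2 : ℕ) : ℝ) *
      ((4 * t * D * 2 ^ (D - 1) + (6 * t) ^ D + 4 * t * D * (7 * t) ^ (D - 1) + 1 : ℕ) : ℝ) ^
        ((2 : ℝ) / ((D : ℝ) - 1)), ?_, ?_⟩
  · have hCA : (0 : ℝ) < ((36 * D ^ 2 * t ^ 2 : ℕ) : ℝ) := by
      have hD2 : 1 ≤ D ^ 2 := Nat.one_le_pow _ _ (by omega)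
      have ht2 : 1 ≤ t ^ 2 := Nat.one_le_pow _ _ ht
      exact_mod_cast (show 0 < 36 * D ^ 2 * t ^ 2 by nlinarith)
    have hCB : (0 : ℝ) < ((4 * t * D * 2 ^ (D - 1) + (6 * t) ^ D + 4 * t * D * (7 * t) ^ (D - 1) + 1 : ℕ) : ℝ) := by
      exact_mod_cast Nat.succ_pos _
    positivity
  · intro L n k d e G hlocG hlocS hcode
    rcases Nat.eq_zero_or_pos k with hk | hk
    · rw [hk, Nat.cast_zero, zero_mul]
      positivity
    · obtain ⟨M, -, h1, h2⟩ :=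
        SubsystemTorus.exists_scale hD ht e (hlocG.mono hwt) (hlocS.mono hwt) hcode hk
      exact BPTTorus.real_step hD h1 h2

/-- **Bravyi 2011, Eq. (1) for subsystem codes as printed (`D = 2`): `kd² ≤ c(w) · n`** on the `L × L` torus when
both the gauge space and the stabilizer space have range-`w` generators.
[cite: Bravyi2011Subsystem, §1 (p. 4: «the original bound Eq. (1) holds for any 2D subsystem code in which both stabilizer group and the gauge group have spatially local generators»), §8] -/
theorem Bravyi2011_kd2_le_cn_torus_two (w : ℕ) :
    ∃ c : ℝ, 0 < c ∧ ∀ (L n k d : ℕ) (e : Fin n ≃ (Fin 2 → Fin L)) (G : Submodule (ZMod 2) (SympVec n)),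
      HasLocalGeneratorsPeriodic e w G → HasLocalGeneratorsPeriodic e w (gaugeStabilizer G) →
        IsSubsystemCode G k d → (k : ℝ) * (d : ℝ) ^ 2 ≤ c * n := by
  obtain ⟨c, hc, h⟩ := Bravyi2011_kd2_le_cn_torus 2 w le_rfl
  refine ⟨c, hc, fun L n k d e G hlocG hlocS hcode => ?_⟩
  have key := h L n k d e G hlocG hlocS hcode
  have hexp : (2 : ℝ) / (((2 : ℕ) : ℝ) - 1) = ((2 : ℕ) : ℝ) := by norm_num
  rw [hexp, Real.rpow_natCast] at key
  exact key

/-- **Bravyi 2011, Eq. (1) for subsystem codes, open boundary conditions.**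
[cite: Bravyi2011Subsystem, §1 (p. 4) and §8; HaahPreskill2012, §2 («with either open or periodic boundary conditions»)] -/
theorem Bravyi2011_kd2_le_cn (D w : ℕ) (hD : 2 ≤ D) :
    ∃ c : ℝ, 0 < c ∧ ∀ (L n k d : ℕ) (e : Fin n ≃ (Fin D → Fin L)) (G : Submodule (ZMod 2) (SympVec n)),
      HasLocalGenerators e w G → HasLocalGenerators e w (gaugeStabilizer G) →
        IsSubsystemCode G k d → (k : ℝ) * (d : ℝ) ^ ((2 : ℝ) / ((D : ℝ) - 1)) ≤ c * n := by
  obtain ⟨c, hc, h⟩ := Bravyi2011_kd2_le_cn_torus D w hD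
  exact ⟨c, hc, fun L n k d e G hlocG hlocS hcode => h L n k d e G hlocG.toPeriodic hlocS.toPeriodic hcode⟩

end Literature.InformationTheory.QuantumCodes
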